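import Summits.BirchSwinnertonDyer.BirchSwinnertonDyer.Theorems.ByReductionTypeAtTwoOrdKatoHalfAtTwoIsoZetaNotTwoDivisible
import Summits.BirchSwinnertonDyer.BirchSwinnertonDyer.Theorems.ByReductionTypeAtTwoOrdKatoHalfAtTwoIsoColemanMuPoitouTateGreenbergMu
import Literature.NumberTheory.EllipticCurves.Kato2004.IwasawaCohomologyUniqueProofs
import Literature.NumberTheory.EllipticCurves.Kato2004.EulerSystemClasses
import Literature.NumberTheory.EllipticCurves.Kato2004.DivisibilityInputs
import Literature.NumberTheory.EllipticCurves.PAdicLFunctionIntegralityAtTwoAutoProofs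
import Literature.NumberTheory.EllipticCurves.IwasawaSelmerDualProofs
import Literature.NumberTheory.EllipticCurves.KatoFineSelmerDualProofs
import Summits.BirchSwinnertonDyer.BirchSwinnertonDyer.Theorems.ByReductionTypeAtTwoAnalyticMuZeroShapes
import HarnessLib

/-!
# Route ByReductionTypeAtTwo, crux `OrdKatoHalfAtTwoIso` (stmt-BirchSwinnertonDyer-19573), line `steinberg-fibre-at-two`,
# F1 slot = child stmt-BirchSwinnertonDyer-24097: NECESSITY — conjunct 1 (F1μι⁻) IMPLIES G11⁻ and N2D⁻ (modulo modularity only),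
# hence F1μι⁻ ⟺ G11⁻ ∧ N2D⁻ and the WHOLE child ⟺ G11⁺ ∧ G11⁻ ∧ N2D⁻, kernel `iff`s modulo print

Seat `cruxlead-stmt-BirchSwinnertonDyer-19573-w3` g8 (prover WIDTH under the LEAD `cruxlead-19573`; HOME `run/shared/lean/pub/bsd-2adic/`;
`--supports` stmt-BirchSwinnertonDyer-24097).  THEOREMS ONLY (no definition, no named fact, no `sorry`, no instance).  HONEST FRAMING
(cell bsd-2adic): BSD is not proved by any of this; the child 24097, its halves, G11∓, N2D⁻ and the crux are NOT proved here — they are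
displayed OPEN statements (G11∓ = Greenberg Conj. 1.11 at `2` on the two onto cells, published conjecture; N2D⁻ = «Kato's `2`-adic Euler
system is not `2`-divisible in `𝐇¹_Γ(T₂W)` on the `Δ < 0` onto cell», memo); the print inputs enter BY NAME (PUB `OrdPublishedInputsAtTwo`,
Cassels `bsdRHS_eq_of_isIsogenous`, Abbes–Ullmo, Poitou–Tate exactness p729889, the ordinary-kernel functional p727215, Kato 12.4 (2) `thm12_4`).

WHAT (w3 g7 proved V♭⁻ ⟺ G11⁻ ∧ N2D⁻ and F1μι⁻ ⟸ {G11⁻, N2D⁻}; the lead g10 / w3 g6 proved the `0 < Δ` conjunct ⟺ G11⁺; MISSING was the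
necessity of N2D⁻ and G11⁻ from F1μι⁻ ITSELF, i.e. from the child's own text — supplied here):
* §1 `isEulerSystemClassTwo_map_of_proj_eq`, `exists_esClass_not_mem_forall_of_exists` — genuine Euler-system classes and their
  non-divisibility TRANSPORT along the proj-compatible isomorphisms between pinned carriers (`IwasawaH1Data.exists_linearEquiv`), so an
  `∃ I`-statement about them is a `∀ I`-statement.
* §2 `exists_esClass_not_mem_of_iotaNegDisc_at` — AT ONE curve of the `Δ < 0` onto cell with a newform and dual data, F1μι⁻ yields a
  genuine class `∉ (2)·𝐇¹_Γ` in EVERY pinned carrier: image clause at `(2)` + analytic `μ₂ = 0` (PROVED on the onto locus,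
  `AnalyticMuTwo.exists_norm_coeff_padicLFunction_two_eq_one_of_surj`) + INT2-AUTO (PROVED) + `(2)` prime + span clause — the argument of
  the Negative lemma p691215 (`exists_esClass_not_mem_of_hasZetaColemanMuInputsAtTwo`, sign-free F1μ⁺) run on the ι-keyed text.
* §3 `zetaNotTwoDivisible_of_iotaNegDisc` — **F1μι⁻ + modularity ⟹ N2D⁻** (dual data exist: `selmerDualData`, `nonempty_fineSelmerDualData`);
  `greenbergMuNeg_of_iotaNegDisc` — **F1μι⁻ + modularity ⟹ G11⁻** (the lead's `mu_eq_zero_of_iotaNegDisc`, core Theorem A at `2` PROVED).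
* §4 `iotaNegDisc_iff_greenbergMuNeg_and_notTwoDivisible` — **F1μι⁻ ⟺ G11⁻ ∧ N2D⁻** modulo {p729889, p727215, `thm12_4`, PUB};
  `iotaNegDisc_iff_greenbergMuNeg_and_zetaQuotientMu` — the MU13⁻ currency.
* §5 `ordKatoFineZetaAtTwoResidue_iff_greenbergMu_both_and_notTwoDivisible` — **child 24097 ⟺ G11⁺ ∧ G11⁻ ∧ N2D⁻** modulo
  {p729889, p727215, `thm12_4`, PUB, Cassels, Abbes–Ullmo}: the F1 slot of crux 202 IS Greenberg's Conjecture 1.11 at `2` on the onto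
  good-ordinary cells of both signs plus the `2`-indivisibility of Kato's Euler system on `Δ < 0` — EXACTLY, in the kernel, modulo print.

References: [Kato2004Asterisque] Thm 12.4 (2)(3) (p. 221), Thm 12.6 (p. 222), §13.1 (13.1.1) and Thm 13.4 (pp. 224–226), Thm 17.4 (p. 273),
§17.13 (pp. 279–280); [GreenbergLNM1716] Conj. 1.11 (p. 64); [AbbesUllmo1996] Thm A; [MilneADT2006] I Thm 7.3 (Cassels); tree p691215, p733065,
p734050, p735706, p736704, p738495, p738787.
-/

set_option autoImplicit false
set_option linter.dupNamespace false

noncomputable section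

open scoped Classical MatrixGroups ModularForm NumberField
open CongruenceSubgroup WeierstrassCurve Field IsDedekindDomain NumberField
open Literature.NumberTheory.GaloisRepresentations
open Literature.NumberTheory.GaloisCohomology
open Literature.NumberTheory.EllipticCurves Literature.NumberTheory.EllipticCurves.ModularForms
  Literature.NumberTheory.EllipticCurves.GreenbergSelmer
open Literature.NumberTheory.EllipticCurves.Kato2004
  Literature.NumberTheory.EllipticCurves.Kato2004.EulerSystemValues
open Literature.NumberTheory.EllipticCurves.IwasawaDual
open Literature.NumberTheory.EllipticCurves.Rank1Residual
open Literature.NumberTheory.EllipticCurves.Greenberg1999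
open Summit.BirchSwinnertonDyer.Rank1Residual Summit.BirchSwinnertonDyer.Rank1Residual.X5
open Summit.BirchSwinnertonDyer.BirchSwinnertonDyer.Theses.ByReductionTypeAtTwo

namespace Summit.BirchSwinnertonDyer.BirchSwinnertonDyer.Theorems.SteinbergFibreAtTwo

/-! ## §1 Transport of genuine classes and of non-divisibility along the pin isomorphisms -/

section Transport

variable {W : WeierstrassCurve ℚ} [W.IsElliptic] [ContinuousSMul ℤ_[2] (W.tateModule 2)]
  [Module.Free ℤ_[2] (W.tateModule 2)] [Module.Finite ℤ_[2] (W.tateModule 2)]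
  {κ : ZpExtension ℚ 2} {hκ : κ.IsCyclotomic} {γ : absoluteGaloisGroup ℚ}

/-- **Genuine Euler-system classes transport along proj-compatible maps of pinned carriers**: `IsEulerSystemClassTwo` is a statement
about the layer components `proj n s`, so a map `e : I.H → I′.H` with `I′.proj n (e x) = I.proj n x` carries genuine classes to genuine
classes. [cite: Kato2004Asterisque, §13.1 (13.1.1) and Thm. 13.4 (pp. 224–226)] -/
theorem isEulerSystemClassTwo_map_of_proj_eq {I I' : IwasawaH1Data W 2 κ γ} (e : I.H → I'.H)
    (he : ∀ (n : ℕ) (x : I.H), I'.proj n (e x) = I.proj n x) {s : I.H} (hs : IsEulerSystemClassTwo W hκ I s) :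
    IsEulerSystemClassTwo W hκ I' (e s) := by
  obtain ⟨S, hS, z, hES, hint, hproj⟩ := hs
  exact ⟨S, hS, z, hES, hint, fun n => by rw [he, hproj n]⟩

/-- **«Some pinned carrier has a genuine class outside `𝔞·𝐇¹_Γ`» ⟹ «every pinned carrier does»** (uniqueness of the pin
`IwasawaH1Data.exists_linearEquiv`: a `Λ`-isomorphism compatible with all `proj n`; it preserves genuine classes (§1) and `𝔞·𝐇¹_Γ`).
[cite: Kato2004Asterisque, §12.2 (12.2.1) (p. 220), §13.8 (p. 228)] -/
theorem exists_esClass_not_mem_forall_of_exists (hγ : κ.IsTopGenerator γ) (𝔞 : Ideal (IwasawaAlgebra 2))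
    (h : ∃ (I : IwasawaH1Data W 2 κ γ) (s : I.H), IsEulerSystemClassTwo W hκ I s ∧
      s ∉ 𝔞 • (⊤ : Submodule (IwasawaAlgebra 2) I.H))
    (I' : IwasawaH1Data W 2 κ γ) :
    ∃ s' : I'.H, IsEulerSystemClassTwo W hκ I' s' ∧ s' ∉ 𝔞 • (⊤ : Submodule (IwasawaAlgebra 2) I'.H) := by
  obtain ⟨I, s, hs, hsn⟩ := h
  obtain ⟨e, he⟩ := I.exists_linearEquiv I' hγ
  refine ⟨e s, isEulerSystemClassTwo_map_of_proj_eq e he hs, fun hmem => hsn ?_⟩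
  have h' : e.symm (e s) ∈ (𝔞 • (⊤ : Submodule (IwasawaAlgebra 2) I'.H)).map (e.symm : I'.H →ₗ[IwasawaAlgebra 2] I.H) :=
    Submodule.mem_map_of_mem hmem
  rw [Submodule.map_smul'', e.symm_apply_apply] at h'
  exact Submodule.smul_mono le_rfl le_top h'

end Transport

/-! ## §2 At one curve of the `Δ < 0` onto cell: F1μι⁻ yields a `2`-indivisible genuine class in every pinned carrier -/

/-- **Extraction (the ι-keyed twin of the Negative lemma's `exists_esClass_not_mem_of_hasZetaColemanMuInputsAtTwo`).**  At `W` good ordinary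
at `2`, `ρ̄₂` onto, `Δ < 0`, with a newform `f`, a normalised cyclotomic pair and dual data `D`, `Y`, F1μι⁻ gives `(I, Z, P, ℓ, τ, π)` with the
span clause and the image clause at `(2)`; INT2-AUTO gives `G₁ ∈ Λ` with `ι G₁ = L₂(f, α)`, the PROVED analytic `μ₂ = 0` on the onto locus
gives `G₁ ∉ (2)`, the image clause gives `s₀ ∉ (2)` with `s₀·G₁ ∈ ℓ(Z)`; `(2)` is prime, so `ℓ(Z) ⊄ (2)`, so `Z ⊄ (2)·𝐇¹_Γ`, so (span
clause) some GENUINE class is `∉ (2)·𝐇¹_Γ` — in `I`, hence (§1) in every pinned carrier.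
[cite: Kato2004Asterisque, Thm. 12.6 (p. 222) and §17.13 (p. 280)] -/
theorem exists_esClass_not_mem_of_iotaNegDisc_at (hNeg : ZetaColemanMuIotaNegDiscAtTwo)
    (W : WeierstrassCurve ℚ) [W.IsElliptic] [W.IsGloballyMinimal]
    [ContinuousSMul ℤ_[2] (W.tateModule 2)] [Module.Free ℤ_[2] (W.tateModule 2)] [Module.Finite ℤ_[2] (W.tateModule 2)]
    {N : ℕ} [NeZero N] (f : CuspForm (Gamma0 N) 2)
    (κ : ZpExtension ℚ 2) (γ : absoluteGaloisGroup ℚ) (hκ : κ.IsCyclotomic)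
    (hord : IsOrdinaryAt W 2) (h2 : W.HasSurjectiveModNGaloisRep 2) (hΔ : W.Δ < 0) (hγ : κ.IsTopGenerator γ)
    (hγ' : IsCyclotomicVariable 2 γ) (hf : IsNewformOf W f)
    (D : W.SelmerDualData κ γ) (Y : W.FineSelmerDualData κ γ) (I' : IwasawaH1Data W 2 κ γ) :
    ∃ s : I'.H, IsEulerSystemClassTwo W hκ I' s ∧
      s ∉ IwasawaAlgebra.augIdealP 2 • (⊤ : Submodule (IwasawaAlgebra 2) I'.H) := by
  refine exists_esClass_not_mem_forall_of_exists hγ _ ?_ I'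
  have hgo : GoodOrd W 2 := ⟨hord.1, hord.2⟩
  obtain ⟨I, Z, P, ℓ, τ, π, hZ, -, -, -, himg⟩ := hNeg W f κ γ hκ hord h2 hΔ hγ hγ' hf D Y
  -- `L₂(f, α) ∈ ι(Λ)` (INT2-AUTO, PROVED) and `μ_an = 0` (PROVED): `G₁ ∉ (2)`
  obtain ⟨G₁, hG₁⟩ := exists_iwasawaToPowerSeries_eq_padicLFunction_two_auto (W := W) (f := f) hord hf
  have hμL : G₁ ∉ IwasawaAlgebra.augIdealP 2 :=
    not_mem_augIdealP_of_norm_coeff_eq_one hG₁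
      (AnalyticMuTwo.exists_norm_coeff_padicLFunction_two_eq_one_of_surj W hgo h2 hf)
  -- the image clause at `(2)`: `s₀ ∉ (2)`, `s₀·G₁ ∈ ℓ(Z)`
  obtain ⟨s₀, hs₀, hsG⟩ := himg G₁ hG₁
  -- hence some zeta class `z ∈ Z` is not divisible by `2` in `𝐇¹`
  have hz : ∃ z ∈ Z, z ∉ IwasawaAlgebra.augIdealP 2 • (⊤ : Submodule (IwasawaAlgebra 2) I.H) := by
    by_contra hcon
    push Not at hcon
    have hZle : Z ≤ IwasawaAlgebra.augIdealP 2 • (⊤ : Submodule (IwasawaAlgebra 2) I.H) :=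
      fun z hz => hcon z hz
    have hsub : Submodule.map (P.subtype ∘ₗ ℓ) Z ≤
        (IwasawaAlgebra.augIdealP 2 • ⊤ : Submodule (IwasawaAlgebra 2) (IwasawaAlgebra 2)) :=
      (Submodule.map_mono hZle).trans
        (by rw [Submodule.map_smul'']; exact Submodule.smul_mono le_rfl le_top)
    have htop : (IwasawaAlgebra.augIdealP 2 • ⊤ : Submodule (IwasawaAlgebra 2) (IwasawaAlgebra 2)) =
        IwasawaAlgebra.augIdealP 2 := by
      rw [Ideal.smul_eq_mul, Ideal.mul_top]
    have hsG' : s₀ * G₁ ∈ IwasawaAlgebra.augIdealP 2 := by rw [← htop]; exact hsub hsG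
    rcases (IwasawaAlgebra.isPrime_augIdealP_holds 2).mem_or_mem hsG' with h' | h'
    · exact hs₀ h'
    · exact hμL h'
  obtain ⟨z, hzZ, hz2⟩ := hz
  obtain ⟨s, hs, hsp⟩ := exists_mem_not_mem_of_le_span hZ hzZ hz2
  exact ⟨I, s, hs, hsp⟩

/-! ## §3 F1μι⁻ + modularity ⟹ N2D⁻ and ⟹ G11⁻ -/

/-- **NECESSITY of N2D⁻: F1μι⁻ + PUB (modularity conjunct only) ⟹ `ZetaNotTwoDivisibleTwoOrdNegDisc`.**  At a curve of the `Δ < 0` onto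
cell a newform exists (modularity, PUB conjunct 1), normalised cyclotomic dual data exist (`selmerDualData`, `nonempty_fineSelmerDualData`,
tree constructions), and §2 applies.  So the line's excess N2D⁻ over Greenberg's conjecture is NOT an artefact of the split: the child's own
`Δ < 0` text commits to it.  CONDITIONAL on the displayed OPEN F1μι⁻; nothing closed.
[cite: Kato2004Asterisque, Thm. 12.6 (p. 222), §13.1 (pp. 224–225), §17.13 (p. 280)] -/
theorem zetaNotTwoDivisible_of_iotaNegDisc (hPub : OrdPublishedInputsAtTwo) (hNeg : ZetaColemanMuIotaNegDiscAtTwo) :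
    ZetaNotTwoDivisibleTwoOrdNegDisc := by
  intro W _ _ _ _ _ κ γ hκ hγ hΔ hord h2 hγ' I
  obtain ⟨hmod, -, -, -⟩ := hPub
  haveI : NeZero (W.conductorNorm ℤ) := ⟨(W.conductorNorm_pos_holds).ne'⟩
  obtain ⟨Dm⟩ := hmod W
  obtain ⟨Y⟩ := W.nonempty_fineSelmerDualData κ hγ
  exact exists_esClass_not_mem_of_iotaNegDisc_at hNeg W Dm.f κ γ hκ hord h2 hΔ hγ hγ' Dm.isNewformOf
    (W.selmerDualData κ hγ) Y I

/-- **NECESSITY of G11⁻: F1μι⁻ + PUB (modularity conjunct only) ⟹ `GreenbergMuZeroTwoOrdNegDisc`** — `μ(X) = 0` for every normalised cyclotomic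
Selmer dual datum on the `Δ < 0` onto cell, by the lead's `mu_eq_zero_of_iotaNegDisc` (engine: the PROVED core Theorem A at `2` on `Δ < 0`,
p669276) at a newform supplied by modularity.  (w3 g7's `greenbergMuZeroTwoOrdNegDisc_of_muFreeValue_negDisc` is this composed with V♭⁻ ⇒ F1μι⁻.)
CONDITIONAL; nothing closed. [cite: GreenbergLNM1716, Conj. 1.11 (p. 64)] [cite: Kato2004Asterisque, Thm. 17.4 (1) (p. 273), §17.13 (pp. 279–280)] -/
theorem greenbergMuNeg_of_iotaNegDisc (hPub : OrdPublishedInputsAtTwo) (hNeg : ZetaColemanMuIotaNegDiscAtTwo) :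
    GreenbergMuZeroTwoOrdNegDisc := by
  intro W _ _ hgo h2 hΔ κ γ hκ hγ hγ' D
  obtain ⟨hmod, -, -, -⟩ := hPub
  haveI : NeZero (W.conductorNorm ℤ) := ⟨(W.conductorNorm_pos_holds).ne'⟩
  obtain ⟨Dm⟩ := hmod W
  exact mu_eq_zero_of_iotaNegDisc hNeg W hgo h2 hΔ Dm.f Dm.isNewformOf κ γ hκ hγ hγ' D

/-! ## §4 F1μι⁻ ⟺ G11⁻ ∧ N2D⁻ (and the MU13⁻ currency), kernel `iff`s modulo print -/

/-- **F1μι⁻ ⟺ G11⁻ ∧ N2D⁻ modulo print BY NAME** (Poitou–Tate exactness p729889, the ordinary-kernel functional p727215, Kato 12.4 (2) `thm12_4`,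
PUB): (⟸) w3 g7's `zetaColemanMuIotaNegDiscAtTwo_of_greenbergMuNeg_of_notTwoDivisible`; (⟹) §3, which uses PUB's modularity conjunct ONLY.
So conjunct 1 of child 24097 is EXTENT-EQUAL, in the kernel modulo print, to «Greenberg Conj. 1.11 at `2` on the `Δ < 0` onto cell» ∧ «Kato's
`2`-adic Euler system is not `2`-divisible in `𝐇¹_Γ(T₂W)` there».  Neither side is proved; nothing asserted.
[cite: GreenbergLNM1716, Conj. 1.11 (p. 64)] [cite: Kato2004Asterisque, Thm. 12.4 (2)(3) (p. 221), Thm. 12.6 (p. 222), §17.13 (pp. 279–280)] -/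
theorem iotaNegDisc_iff_greenbergMuNeg_and_notTwoDivisible (hPT : exists_lambdaAdicLocalTatePairing_poitouTate_exact)
    (hOK : exists_ordinaryKernelFunctional) (h12 : thm12_4) (hPub : OrdPublishedInputsAtTwo) :
    ZetaColemanMuIotaNegDiscAtTwo ↔ (GreenbergMuZeroTwoOrdNegDisc ∧ ZetaNotTwoDivisibleTwoOrdNegDisc) :=
  ⟨fun hNeg => ⟨greenbergMuNeg_of_iotaNegDisc hPub hNeg, zetaNotTwoDivisible_of_iotaNegDisc hPub hNeg⟩,
    fun h => zetaColemanMuIotaNegDiscAtTwo_of_greenbergMuNeg_of_notTwoDivisible hPT hOK hPub h12 h.1 h.2⟩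

/-- **F1μι⁻ ⟺ G11⁻ ∧ MU13⁻ modulo print** (the zeta-quotient currency; `thm12_4` enters only through MU13⁻ ⟸ N2D⁻ on the (⟹) side).
[cite: GreenbergLNM1716, Conj. 1.11 (p. 64)] [cite: Kato2004Asterisque, Thm. 12.4 (2)(3) (p. 221), Thm. 12.6 (p. 222), §17.13 (pp. 279–280)] -/
theorem iotaNegDisc_iff_greenbergMuNeg_and_zetaQuotientMu (hPT : exists_lambdaAdicLocalTatePairing_poitouTate_exact)
    (hOK : exists_ordinaryKernelFunctional) (h12 : thm12_4) (hPub : OrdPublishedInputsAtTwo) :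
    ZetaColemanMuIotaNegDiscAtTwo ↔ (GreenbergMuZeroTwoOrdNegDisc ∧ ZetaQuotientMuZeroTwoOrdNegDisc) := by
  rw [zetaQuotientMu_iff_notTwoDivisible h12]
  exact iotaNegDisc_iff_greenbergMuNeg_and_notTwoDivisible hPT hOK h12 hPub

/-- **NECESSITY alone, print-light: F1μι⁻ ⟹ G11⁻ ∧ N2D⁻ modulo PUB only** (no Poitou–Tate, no functional, no `thm12_4`).
[cite: GreenbergLNM1716, Conj. 1.11 (p. 64)] [cite: Kato2004Asterisque, Thm. 12.6 (p. 222), §17.13 (p. 280)] -/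
theorem greenbergMuNeg_and_notTwoDivisible_of_iotaNegDisc (hPub : OrdPublishedInputsAtTwo) (hNeg : ZetaColemanMuIotaNegDiscAtTwo) :
    GreenbergMuZeroTwoOrdNegDisc ∧ ZetaNotTwoDivisibleTwoOrdNegDisc :=
  ⟨greenbergMuNeg_of_iotaNegDisc hPub hNeg, zetaNotTwoDivisible_of_iotaNegDisc hPub hNeg⟩

/-! ## §5 The whole child 24097 ⟺ G11⁺ ∧ G11⁻ ∧ N2D⁻ modulo print -/

/-- **The PAIR child `OrdKatoFineZetaAtTwoResidue` (stmt-BirchSwinnertonDyer-24097) ⟺ G11⁺ ∧ G11⁻ ∧ N2D⁻, kernel `iff` modulo print BY NAME**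
(Poitou–Tate exactness p729889, the ordinary-kernel functional p727215, `thm12_4`, PUB, Cassels `bsdRHS_eq_of_isIsogenous`, Abbes–Ullmo): the
child unfolds to F1μι⁻ ∧ the `0 < Δ` conjunct (`ordKatoFineZetaAtTwoResidue_iff_halves`); F1μι⁻ ⟺ G11⁻ ∧ N2D⁻ (§4); the `0 < Δ` conjunct ⟺ G11⁺
(`ordKatoHalfAtTwoIsoPosDisc_of_greenbergMuZero` / `greenbergMuZeroTwoOrdPosDisc_of_posDisc`, lead g10 merge, w3 g6 p734050).  NET: the F1 slot of
crux 202 is Greenberg's Conjecture 1.11 at `2` on the onto good-ordinary cells of BOTH signs (published conjecture) plus the `2`-indivisibility of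
Kato's Euler system on `Δ < 0` (memo) — nothing more, nothing less, modulo print.  Neither side is proved; nothing asserted.
[cite: GreenbergLNM1716, Conj. 1.11 (p. 64)] [cite: Kato2004Asterisque, Thm. 12.6 (p. 222), Thm. 17.4 (1)(2) (p. 273), §17.13 (pp. 279–280)]
[cite: AbbesUllmo1996, Thm. A] [cite: MilneADT2006, Thm. I.7.3 (Cassels)] -/
theorem ordKatoFineZetaAtTwoResidue_iff_greenbergMu_both_and_notTwoDivisible
    (hPT : exists_lambdaAdicLocalTatePairing_poitouTate_exact) (hOK : exists_ordinaryKernelFunctional) (h12 : thm12_4)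
    (hPub : OrdPublishedInputsAtTwo) (hCassels : bsdRHS_eq_of_isIsogenous)
    (hAU : abbesUllmo_not_dvd_maninConstant_of_not_dvd_level) :
    OrdKatoFineZetaAtTwoResidue ↔
      (GreenbergMuZeroTwoOrdPosDisc ∧ GreenbergMuZeroTwoOrdNegDisc ∧ ZetaNotTwoDivisibleTwoOrdNegDisc) := by
  obtain ⟨_, _, h17, _⟩ := id hPub
  rw [ordKatoFineZetaAtTwoResidue_iff_halves, iotaNegDisc_iff_greenbergMuNeg_and_notTwoDivisible hPT hOK h12 hPub]
  constructor
  · rintro ⟨⟨hG, hN⟩, hPos⟩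
    exact ⟨greenbergMuZeroTwoOrdPosDisc_of_posDisc hPos hPub hCassels hAU, hG, hN⟩
  · rintro ⟨hGp, hG, hN⟩
    exact ⟨⟨hG, hN⟩, ordKatoHalfAtTwoIsoPosDisc_of_greenbergMuZero hGp hAU h17⟩

/-- **The child from the three displayed statements, BY NAME** (the (⟸) half of §5, for the skeleton: G11⁺, G11⁻, N2D⁻ + print ⟹ 24097).
CONDITIONAL on the displayed OPEN statements; the item is NOT closed by this. [cite: GreenbergLNM1716, Conj. 1.11 (p. 64)]
[cite: Kato2004Asterisque, Thm. 12.4 (2)(3) (p. 221), Thm. 17.4 (1)(2) (p. 273), §17.13 (pp. 279–280)] [cite: AbbesUllmo1996, Thm. A] -/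
theorem ordKatoFineZetaAtTwoResidue_of_greenbergMu_both_of_notTwoDivisible
    (hPT : exists_lambdaAdicLocalTatePairing_poitouTate_exact) (hOK : exists_ordinaryKernelFunctional) (h12 : thm12_4)
    (hPub : OrdPublishedInputsAtTwo) (hAU : abbesUllmo_not_dvd_maninConstant_of_not_dvd_level)
    (hGp : GreenbergMuZeroTwoOrdPosDisc) (hG : GreenbergMuZeroTwoOrdNegDisc) (hN : ZetaNotTwoDivisibleTwoOrdNegDisc) :
    OrdKatoFineZetaAtTwoResidue := by
  obtain ⟨_, _, h17, _⟩ := id hPub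
  exact ordKatoFineZetaAtTwoResidue_of_halves
    (zetaColemanMuIotaNegDiscAtTwo_of_greenbergMuNeg_of_notTwoDivisible hPT hOK hPub h12 hG hN)
    (ordKatoHalfAtTwoIsoPosDisc_of_greenbergMuZero hGp hAU h17)

end Summit.BirchSwinnertonDyer.BirchSwinnertonDyer.Theorems.SteinbergFibreAtTwo

end
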